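import Literature.Analysis.FunctionSpaces.PolchinskiSmoothing
import Literature.Analysis.FunctionSpaces.PolchinskiUniformSlope
import Mathlib.Analysis.Calculus.MeanValue
import Mathlib.Analysis.Calculus.Deriv.Inv
import HarnessLib

/-!
# `C_b²` calculus with explicit derivative data, and uniform time slopes: products, inverses, sums
# (bookkeeping for the spatial/temporal derivatives of `P_{0,t}F = W_t/Z_t` in Bauerschmidt–Bodineau–Dagallier, Theorem 3)

Topic `Literature/Analysis/FunctionSpaces`; "proof architecture" file behind the named fact
`Polchinski.BauerschmidtBodineau_multiscaleBakryEmery` ([BBD] Theorem 3, `MultiscaleBakryEmery.lean`).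
The dual identity with a time-dependent test function (`hasDerivAt_renormExpect_family`,
`PolchinskiDualGeneratorFamily.lean`) asks of the family `G_t` that `G_t` be `C_b²` in space with EXPLICIT
derivative fields `DG`, `D²G` (bounded, `D²G` uniformly continuous) and that `s ↦ G_s(y)` have a uniform-in-`y`
slope.  In [BBD]'s proof of Theorem 3 the families are `Φ(P_{0,t}F)` and `(∇√P_{0,t}F)²_{Ċ_t}` with
`P_{0,t}F = W_t/Z_t` (p0015 L9–12, p0016), i.e. rational expressions in finitely many Gaussian averages
("jets", `PolchinskiSemigroupJets.lean`).  This file supplies the closure rules that assemble such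
expressions: for scalar functions carrying `C_b²` data `(f, Df, D²f)` with bounds — PRODUCTS (the
Leibniz Hessian of `PolchinskiSmoothing.lean`), INVERSES of functions bounded below (the factor `1/Z_t`,
[BBD] `e^{+V_t} = 1/Z_t`), scalar multiples, sums — and the corresponding rules for uniform time slopes
(`PolchinskiUniformSlope.lean` has sum/product/chain; here: inverse, finite sums, space-independent
factors such as `Ċ_t^{ij}`), plus the uniform-continuity algebra used for the slope functions.

The `C_b²` DATA of a scalar function `f : ℝ^N → ℝ` with bounds `(K₀, K₁, K₂)` is the conjunction
`(∀ x, HasFDerivAt f (f₁ x) x) ∧ (∀ x, HasFDerivAt f₁ (f₂ x) x) ∧ (∀ x, |f x| ≤ K₀) ∧ (∀ x, ‖f₁ x‖ ≤ K₁) ∧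
(∀ x, ‖f₂ x‖ ≤ K₂) ∧ UniformContinuous f₂` (spelled out; no definition is introduced).

## Main results (sorry-free; no new definitions, no new named facts)

* uniform continuity algebra: `uc_of_hasFDerivAt_bound`, `uc_mul`, `uc_inv`, `uc_smul`, `uc_smulRight`,
  `uc_finset_sum`;
* `C_b²` data: `cb2_mul`, `cb2_inv`, `cb2_const_mul`, `cb2_add`, `cb2_sub`, `cb2_sum`;
* uniform slopes: `uniformSlope_inv`, `uniformSlope_of_hasDerivAt`, `uniformSlope_sum`, `uniformSlope_sub`,
  `uniformSlope_congr`.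

Nothing here concerns Yang–Mills.

## References

* [BauerschmidtBodineauDagallier2023] R. Bauerschmidt, T. Bodineau, B. Dagallier, Probab. Surveys 21
  (2024) 200–290, arXiv:2307.07619 — proof of Theorem 3 p0016, Lemma 1 p0017 (product/quotient rules
  for `(∇√F)² = (∇F)²/(4F)`). READ (held text).
* [Rudin1976] W. Rudin, Principles of Mathematical Analysis, 3rd ed. — Thm 4.9 (algebra of continuous
  functions), Thm 5.3 (product and quotient rules), Thm 9.19 (mean value inequality).
-/

noncomputable section

-- nested operator-norm instances `E →L[ℝ] E →L[ℝ] ℝ`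
set_option maxSynthPendingDepth 3

open Filter Topology Set

namespace Literature.Analysis.FunctionSpaces

namespace Polchinski

variable {N : ℕ}

/-! ### Uniform continuity algebra for bounded functions on `ℝ^N` -/

section UC

/-- Uniform continuity from a bounded Fréchet derivative (mean value inequality).
[cite: Rudin1976, Thm 9.19] -/
theorem uc_of_hasFDerivAt_bound {Y : Type*} [NormedAddCommGroup Y] [NormedSpace ℝ Y]
    {H : EuclideanSpace ℝ (Fin N) → Y} {DH : EuclideanSpace ℝ (Fin N) → EuclideanSpace ℝ (Fin N) →L[ℝ] Y}
    (h1 : ∀ x, HasFDerivAt H (DH x) x) {K : ℝ} (hK : ∀ x, ‖DH x‖ ≤ K) : UniformContinuous H := by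
  have hK0 : 0 ≤ K := le_trans (norm_nonneg _) (hK 0)
  have hlip : ∀ a b : EuclideanSpace ℝ (Fin N), ‖H a - H b‖ ≤ K * ‖a - b‖ := fun a b =>
    Convex.norm_image_sub_le_of_norm_hasFDerivWithin_le (𝕜 := ℝ) (s := univ)
      (fun x _ => (h1 x).hasFDerivWithinAt) (fun x _ => hK x) convex_univ (mem_univ b) (mem_univ a)
  rw [Metric.uniformContinuous_iff]
  intro ε hε
  refine ⟨ε / (K + 1), by positivity, fun {a b} hab => ?_⟩
  rw [dist_eq_norm] at hab ⊢
  calc ‖H a - H b‖ ≤ K * ‖a - b‖ := hlip a b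
    _ ≤ K * (ε / (K + 1)) := mul_le_mul_of_nonneg_left hab.le hK0
    _ < ε := by
      rw [mul_div_assoc', div_lt_iff₀ (by positivity)]
      nlinarith

/-- A bounded uniformly continuous scalar function times a bounded uniformly continuous vector-valued
function is uniformly continuous. [cite: Rudin1976, Thm 4.9] -/
theorem uc_smul {Y : Type*} [NormedAddCommGroup Y] [NormedSpace ℝ Y]
    {a : EuclideanSpace ℝ (Fin N) → ℝ} {b : EuclideanSpace ℝ (Fin N) → Y}
    (ha : UniformContinuous a) (hb : UniformContinuous b) {A : ℝ} (hA : ∀ x, |a x| ≤ A)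
    {B : ℝ} (hB : ∀ x, ‖b x‖ ≤ B) : UniformContinuous fun x => a x • b x := by
  have hA0 : 0 ≤ A := le_trans (abs_nonneg _) (hA 0)
  have hB0 : 0 ≤ B := le_trans (norm_nonneg _) (hB 0)
  rw [Metric.uniformContinuous_iff]
  intro ε hε
  obtain ⟨δa, hδa, ha'⟩ := Metric.uniformContinuous_iff.mp ha (ε / (2 * (B + 1))) (by positivity)
  obtain ⟨δb, hδb, hb'⟩ := Metric.uniformContinuous_iff.mp hb (ε / (2 * (A + 1))) (by positivity)
  refine ⟨min δa δb, lt_min hδa hδb, fun {x y} hxy => ?_⟩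
  have h1 := ha' (lt_of_lt_of_le hxy (min_le_left _ _))
  have h2 := hb' (lt_of_lt_of_le hxy (min_le_right _ _))
  rw [dist_eq_norm] at h1 h2 ⊢
  have hsplit : a x • b x - a y • b y = a x • (b x - b y) + (a x - a y) • b y := by
    rw [smul_sub, sub_smul]; abel
  rw [hsplit]
  calc ‖a x • (b x - b y) + (a x - a y) • b y‖
      ≤ ‖a x • (b x - b y)‖ + ‖(a x - a y) • b y‖ := norm_add_le _ _
    _ = |a x| * ‖b x - b y‖ + |a x - a y| * ‖b y‖ := by
        rw [norm_smul, norm_smul, Real.norm_eq_abs, Real.norm_eq_abs]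
    _ ≤ A * (ε / (2 * (A + 1))) + (ε / (2 * (B + 1))) * B := by
        have h1' : |a x - a y| ≤ ε / (2 * (B + 1)) := by rw [← Real.norm_eq_abs]; exact h1.le
        exact add_le_add (mul_le_mul (hA x) h2.le (norm_nonneg _) hA0)
          (mul_le_mul h1' (hB y) (norm_nonneg _) (by positivity))
    _ < ε := by
        have h3 : A * (ε / (2 * (A + 1))) < ε / 2 := by
          rw [mul_div_assoc', div_lt_div_iff₀ (by positivity) (by positivity)]; nlinarith
        have h4 : (ε / (2 * (B + 1))) * B < ε / 2 := by
          rw [div_mul_eq_mul_div, div_lt_div_iff₀ (by positivity) (by positivity)]; nlinarith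
        linarith

/-- Product of bounded uniformly continuous real functions. [cite: Rudin1976, Thm 4.9] -/
theorem uc_mul {a b : EuclideanSpace ℝ (Fin N) → ℝ} (ha : UniformContinuous a) (hb : UniformContinuous b)
    {A : ℝ} (hA : ∀ x, |a x| ≤ A) {B : ℝ} (hB : ∀ x, |b x| ≤ B) :
    UniformContinuous fun x => a x * b x :=
  uc_smul (Y := ℝ) ha hb hA (fun x => by rw [Real.norm_eq_abs]; exact hB x)

/-- Inverse of a uniformly continuous function bounded below by `m > 0`. [cite: Rudin1976, Thm 4.9] -/
theorem uc_inv {a : EuclideanSpace ℝ (Fin N) → ℝ} (ha : UniformContinuous a) {m : ℝ} (hm : 0 < m)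
    (hma : ∀ x, m ≤ a x) : UniformContinuous fun x => (a x)⁻¹ := by
  rw [Metric.uniformContinuous_iff]
  intro ε hε
  obtain ⟨δ, hδ, ha'⟩ := Metric.uniformContinuous_iff.mp ha (ε * m ^ 2) (by positivity)
  refine ⟨δ, hδ, fun {x y} hxy => ?_⟩
  have h := ha' hxy
  rw [dist_eq_norm, Real.norm_eq_abs] at h ⊢
  have hx : 0 < a x := hm.trans_le (hma x)
  have hy : 0 < a y := hm.trans_le (hma y)
  rw [inv_sub_inv hx.ne' hy.ne', abs_div, abs_mul, abs_of_pos hx, abs_of_pos hy, abs_sub_comm]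
  rw [div_lt_iff₀ (mul_pos hx hy)]
  calc |a x - a y| < ε * m ^ 2 := h
    _ = ε * (m * m) := by ring
    _ ≤ ε * (a x * a y) := mul_le_mul_of_nonneg_left (mul_le_mul (hma x) (hma y) hm.le hx.le) hε.le

/-- `x ↦ c(x) ⊗ d(x)` (`smulRight`) is uniformly continuous for bounded uniformly continuous covector
fields. [cite: Rudin1976, Thm 4.9] -/
theorem uc_smulRight
    {c d : EuclideanSpace ℝ (Fin N) → EuclideanSpace ℝ (Fin N) →L[ℝ] ℝ}
    (hc : UniformContinuous c) (hd : UniformContinuous d) {Cc : ℝ} (hCc : ∀ x, ‖c x‖ ≤ Cc)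
    {Cd : ℝ} (hCd : ∀ x, ‖d x‖ ≤ Cd) :
    UniformContinuous fun x => (c x).smulRight (d x) := by
  have hC0 : 0 ≤ Cc := le_trans (norm_nonneg _) (hCc 0)
  have hD0 : 0 ≤ Cd := le_trans (norm_nonneg _) (hCd 0)
  rw [Metric.uniformContinuous_iff]
  intro ε hε
  obtain ⟨δc, hδc, hc'⟩ := Metric.uniformContinuous_iff.mp hc (ε / (2 * (Cd + 1))) (by positivity)
  obtain ⟨δd, hδd, hd'⟩ := Metric.uniformContinuous_iff.mp hd (ε / (2 * (Cc + 1))) (by positivity)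
  refine ⟨min δc δd, lt_min hδc hδd, fun {x y} hxy => ?_⟩
  have h1 := hc' (lt_of_lt_of_le hxy (min_le_left _ _))
  have h2 := hd' (lt_of_lt_of_le hxy (min_le_right _ _))
  rw [dist_eq_norm] at h1 h2 ⊢
  have hsplit : (c x).smulRight (d x) - (c y).smulRight (d y) =
      (c x - c y).smulRight (d x) + (c y).smulRight (d x - d y) := by
    refine ContinuousLinearMap.ext fun v => ContinuousLinearMap.ext fun w => ?_
    simp only [_root_.sub_apply, _root_.add_apply, ContinuousLinearMap.smulRight_apply,
      _root_.smul_apply, smul_eq_mul]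
    ring
  rw [hsplit]
  calc ‖(c x - c y).smulRight (d x) + (c y).smulRight (d x - d y)‖
      ≤ ‖(c x - c y).smulRight (d x)‖ + ‖(c y).smulRight (d x - d y)‖ := norm_add_le _ _
    _ = ‖c x - c y‖ * ‖d x‖ + ‖c y‖ * ‖d x - d y‖ := by
        rw [ContinuousLinearMap.norm_smulRight_apply, ContinuousLinearMap.norm_smulRight_apply]
    _ ≤ (ε / (2 * (Cd + 1))) * Cd + Cc * (ε / (2 * (Cc + 1))) :=
        add_le_add (mul_le_mul h1.le (hCd x) (norm_nonneg _) (by positivity))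
          (mul_le_mul (hCc y) h2.le (norm_nonneg _) hC0)
    _ < ε := by
        have h3 : (ε / (2 * (Cd + 1))) * Cd < ε / 2 := by
          rw [div_mul_eq_mul_div, div_lt_div_iff₀ (by positivity) (by positivity)]; nlinarith
        have h4 : Cc * (ε / (2 * (Cc + 1))) < ε / 2 := by
          rw [mul_div_assoc', div_lt_div_iff₀ (by positivity) (by positivity)]; nlinarith
        linarith

/-- Finite sums of uniformly continuous functions into a normed group. [cite: Rudin1976, Thm 4.9] -/
theorem uc_finset_sum {ι : Type*} [DecidableEq ι] {Y : Type*} [NormedAddCommGroup Y] (S : Finset ι)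
    (f : ι → EuclideanSpace ℝ (Fin N) → Y) (h : ∀ i ∈ S, UniformContinuous (f i)) :
    UniformContinuous fun x => ∑ i ∈ S, f i x := by
  induction S using Finset.induction_on with
  | empty => simpa using uniformContinuous_const
  | @insert a S ha ih =>
    have hfun : (fun x => ∑ i ∈ insert a S, f i x) = fun x => f a x + ∑ i ∈ S, f i x :=
      funext fun x => Finset.sum_insert ha
    rw [hfun]
    exact (h a (Finset.mem_insert_self a S)).add
      (ih fun i hi => h i (Finset.mem_insert_of_mem hi))

end UC

/-! ### `C_b²` data: products, inverses, scalar multiples, sums -/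

section Cb2

variable {f g : EuclideanSpace ℝ (Fin N) → ℝ}
  {f1 g1 : EuclideanSpace ℝ (Fin N) → EuclideanSpace ℝ (Fin N) →L[ℝ] ℝ}
  {f2 g2 : EuclideanSpace ℝ (Fin N) → EuclideanSpace ℝ (Fin N) →L[ℝ] EuclideanSpace ℝ (Fin N) →L[ℝ] ℝ}
  {Kf0 Kf1 Kf2 Kg0 Kg1 Kg2 : ℝ}

/-- **Product rule with `C_b²` data** ([BBD] Lemma 1 proof: `(FG)_{ik} = F G_{ik} + F_iG_k + G F_{ik} + G_iF_k`).
[cite: BauerschmidtBodineauDagallier2023, Lemma 1 (proof)] -/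
theorem cb2_mul
    (hf : (∀ x, HasFDerivAt f (f1 x) x) ∧ (∀ x, HasFDerivAt f1 (f2 x) x) ∧ (∀ x, |f x| ≤ Kf0) ∧
      (∀ x, ‖f1 x‖ ≤ Kf1) ∧ (∀ x, ‖f2 x‖ ≤ Kf2) ∧ UniformContinuous f2)
    (hg : (∀ x, HasFDerivAt g (g1 x) x) ∧ (∀ x, HasFDerivAt g1 (g2 x) x) ∧ (∀ x, |g x| ≤ Kg0) ∧
      (∀ x, ‖g1 x‖ ≤ Kg1) ∧ (∀ x, ‖g2 x‖ ≤ Kg2) ∧ UniformContinuous g2) :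
    (∀ x, HasFDerivAt (fun x => f x * g x) (f x • g1 x + g x • f1 x) x) ∧
    (∀ x, HasFDerivAt (fun x => f x • g1 x + g x • f1 x)
      (f x • g2 x + (f1 x).smulRight (g1 x) + (g x • f2 x + (g1 x).smulRight (f1 x))) x) ∧
    (∀ x, |f x * g x| ≤ Kf0 * Kg0) ∧
    (∀ x, ‖f x • g1 x + g x • f1 x‖ ≤ Kf0 * Kg1 + Kg0 * Kf1) ∧
    (∀ x, ‖f x • g2 x + (f1 x).smulRight (g1 x) + (g x • f2 x + (g1 x).smulRight (f1 x))‖ ≤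
      Kf0 * Kg2 + Kf1 * Kg1 + (Kg0 * Kf2 + Kg1 * Kf1)) ∧
    UniformContinuous (fun x => f x • g2 x + (f1 x).smulRight (g1 x) + (g x • f2 x + (g1 x).smulRight (f1 x))) := by
  obtain ⟨hf1, hf2, hf0b, hf1b, hf2b, hfu⟩ := hf
  obtain ⟨hg1, hg2, hg0b, hg1b, hg2b, hgu⟩ := hg
  have hKf0 : 0 ≤ Kf0 := le_trans (abs_nonneg _) (hf0b 0)
  have hKg0 : 0 ≤ Kg0 := le_trans (abs_nonneg _) (hg0b 0)
  have hfu0 : UniformContinuous f := uc_of_hasFDerivAt_bound hf1 hf1b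
  have hgu0 : UniformContinuous g := uc_of_hasFDerivAt_bound hg1 hg1b
  have hfu1 : UniformContinuous f1 := uc_of_hasFDerivAt_bound hf2 hf2b
  have hgu1 : UniformContinuous g1 := uc_of_hasFDerivAt_bound hg2 hg2b
  refine ⟨fun x => (hf1 x).mul (hg1 x), fun x => hasFDerivAt_fderiv_mul hf1 hf2 hg1 hg2 x,
    fun x => ?_, fun x => ?_, fun x => norm_fderiv₂_mul_le_of_bounds hf0b hg0b hf1b hg1b hf2b hg2b x, ?_⟩
  · rw [abs_mul]; exact mul_le_mul (hf0b x) (hg0b x) (abs_nonneg _) hKf0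
  · calc ‖f x • g1 x + g x • f1 x‖ ≤ ‖f x • g1 x‖ + ‖g x • f1 x‖ := norm_add_le _ _
      _ = |f x| * ‖g1 x‖ + |g x| * ‖f1 x‖ := by rw [norm_smul, norm_smul, Real.norm_eq_abs, Real.norm_eq_abs]
      _ ≤ Kf0 * Kg1 + Kg0 * Kf1 :=
        add_le_add (mul_le_mul (hf0b x) (hg1b x) (norm_nonneg _) hKf0)
          (mul_le_mul (hg0b x) (hf1b x) (norm_nonneg _) hKg0)
  · exact ((uc_smul hfu0 hgu hf0b hg2b).add (uc_smulRight hfu1 hgu1 hf1b hg1b)).add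
      ((uc_smul hgu0 hfu hg0b hf2b).add (uc_smulRight hgu1 hfu1 hg1b hf1b))

/-- **Inverse with `C_b²` data** for a function bounded below by `m > 0` (the factor `e^{V_t} = 1/Z_t`,
[BBD] (e:P-def-bis)): `D(1/f) = −Df/f²`, `D²(1/f) = −D²f/f² + 2 Df⊗Df/f³`.
[cite: BauerschmidtBodineauDagallier2023, Proposition 8 (proof)] -/
theorem cb2_inv
    (hf : (∀ x, HasFDerivAt f (f1 x) x) ∧ (∀ x, HasFDerivAt f1 (f2 x) x) ∧ (∀ x, |f x| ≤ Kf0) ∧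
      (∀ x, ‖f1 x‖ ≤ Kf1) ∧ (∀ x, ‖f2 x‖ ≤ Kf2) ∧ UniformContinuous f2)
    {m : ℝ} (hm : 0 < m) (hmf : ∀ x, m ≤ f x) :
    (∀ x, HasFDerivAt (fun x => (f x)⁻¹) (-((f x) ^ 2)⁻¹ • f1 x) x) ∧
    (∀ x, HasFDerivAt (fun x => -((f x) ^ 2)⁻¹ • f1 x)
      (-((f x) ^ 2)⁻¹ • f2 x + ((2 * ((f x)⁻¹ * ((f x) ^ 2)⁻¹)) • f1 x).smulRight (f1 x)) x) ∧
    (∀ x, |(f x)⁻¹| ≤ m⁻¹) ∧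
    (∀ x, ‖-((f x) ^ 2)⁻¹ • f1 x‖ ≤ (m ^ 2)⁻¹ * Kf1) ∧
    (∀ x, ‖-((f x) ^ 2)⁻¹ • f2 x + ((2 * ((f x)⁻¹ * ((f x) ^ 2)⁻¹)) • f1 x).smulRight (f1 x)‖ ≤
      (m ^ 2)⁻¹ * Kf2 + 2 * (m⁻¹ * (m ^ 2)⁻¹) * Kf1 * Kf1) ∧
    UniformContinuous (fun x => -((f x) ^ 2)⁻¹ • f2 x +
      ((2 * ((f x)⁻¹ * ((f x) ^ 2)⁻¹)) • f1 x).smulRight (f1 x)) := by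
  obtain ⟨hf1, hf2, hf0b, hf1b, hf2b, hfu⟩ := hf
  have hpos : ∀ x, 0 < f x := fun x => hm.trans_le (hmf x)
  have hne : ∀ x, f x ≠ 0 := fun x => (hpos x).ne'
  have hne2 : ∀ x, f x ^ 2 ≠ 0 := fun x => pow_ne_zero 2 (hne x)
  have hKf1 : 0 ≤ Kf1 := le_trans (norm_nonneg _) (hf1b 0)
  have hfu0 : UniformContinuous f := uc_of_hasFDerivAt_bound hf1 hf1b
  have hfu1 : UniformContinuous f1 := uc_of_hasFDerivAt_bound hf2 hf2b
  -- first derivative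
  have hD1 : ∀ x, HasFDerivAt (fun x => (f x)⁻¹) (-((f x) ^ 2)⁻¹ • f1 x) x := fun x =>
    (hasDerivAt_inv (hne x)).comp_hasFDerivAt x (hf1 x)
  -- derivative of `−1/f²`
  have hc2 : ∀ x, HasFDerivAt (fun x => -((f x) ^ 2)⁻¹) ((2 * ((f x)⁻¹ * ((f x) ^ 2)⁻¹)) • f1 x) x := by
    intro x
    have hsq : HasFDerivAt (fun x => (f x) ^ 2) ((((2 : ℕ) : ℝ) * f x ^ (2 - 1)) • f1 x) x :=
      (hasDerivAt_pow 2 (f x)).comp_hasFDerivAt x (hf1 x)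
    have h := ((hasDerivAt_inv (hne2 x)).comp_hasFDerivAt x hsq).neg
    refine h.congr_fderiv ?_
    rw [smul_smul, ← neg_smul]
    congr 1
    have hZ3 : ((f x ^ 2) ^ 2)⁻¹ * f x = (f x)⁻¹ * (f x ^ 2)⁻¹ := by
      field_simp
    rw [show (2 - 1 : ℕ) = 1 from rfl, pow_one, Nat.cast_ofNat]
    calc -(-((f x ^ 2) ^ 2)⁻¹ * (2 * f x)) = 2 * (((f x ^ 2) ^ 2)⁻¹ * f x) := by ring
      _ = 2 * ((f x)⁻¹ * (f x ^ 2)⁻¹) := by rw [hZ3]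
  have hD2 : ∀ x, HasFDerivAt (fun x => -((f x) ^ 2)⁻¹ • f1 x)
      (-((f x) ^ 2)⁻¹ • f2 x + ((2 * ((f x)⁻¹ * ((f x) ^ 2)⁻¹)) • f1 x).smulRight (f1 x)) x :=
    fun x => (hc2 x).smul (hf2 x)
  -- bounds on the scalar factors
  have hb1 : ∀ x, |((f x) ^ 2)⁻¹| ≤ (m ^ 2)⁻¹ := fun x => by
    rw [abs_inv, abs_of_pos (pow_pos (hpos x) 2)]
    exact inv_anti₀ (pow_pos hm 2) (pow_le_pow_left₀ hm.le (hmf x) 2)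
  have hb0 : ∀ x, |(f x)⁻¹| ≤ m⁻¹ := fun x => by
    rw [abs_inv, abs_of_pos (hpos x)]
    exact inv_anti₀ hm (hmf x)
  have hb3 : ∀ x, |2 * ((f x)⁻¹ * ((f x) ^ 2)⁻¹)| ≤ 2 * (m⁻¹ * (m ^ 2)⁻¹) := fun x => by
    rw [abs_mul, abs_mul, abs_of_pos (by norm_num : (0:ℝ) < 2)]
    exact mul_le_mul_of_nonneg_left (mul_le_mul (hb0 x) (hb1 x) (abs_nonneg _) (by positivity))
      (by norm_num)
  -- uniform continuity of the scalar factors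
  have hu_inv : UniformContinuous fun x => (f x)⁻¹ := uc_inv hfu0 hm hmf
  have hu_sq : UniformContinuous fun x => ((f x) ^ 2)⁻¹ := by
    have he : (fun x => ((f x) ^ 2)⁻¹) = fun x => (f x)⁻¹ * (f x)⁻¹ := by
      funext x; rw [pow_two, mul_inv]
    rw [he]; exact uc_mul hu_inv hu_inv hb0 hb0
  have hu_negsq : UniformContinuous fun x => -((f x) ^ 2)⁻¹ := hu_sq.neg
  have hb1' : ∀ x, |-((f x) ^ 2)⁻¹| ≤ (m ^ 2)⁻¹ := fun x => by rw [abs_neg]; exact hb1 x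
  have hu3 : UniformContinuous fun x => 2 * ((f x)⁻¹ * ((f x) ^ 2)⁻¹) := by
    have h1 : UniformContinuous fun x => (f x)⁻¹ * ((f x) ^ 2)⁻¹ := uc_mul hu_inv hu_sq hb0 hb1
    have h2 : UniformContinuous fun _ : EuclideanSpace ℝ (Fin N) => (2 : ℝ) := uniformContinuous_const
    exact uc_mul h2 h1 (fun _ => le_rfl) fun x => by
      rw [abs_mul]; exact mul_le_mul (hb0 x) (hb1 x) (abs_nonneg _) (by positivity)
  refine ⟨hD1, hD2, hb0, fun x => ?_, fun x => ?_, ?_⟩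
  · rw [norm_smul, Real.norm_eq_abs, abs_neg]
    exact mul_le_mul (hb1 x) (hf1b x) (norm_nonneg _) (by positivity)
  · calc _ ≤ ‖-((f x) ^ 2)⁻¹ • f2 x‖ + ‖((2 * ((f x)⁻¹ * ((f x) ^ 2)⁻¹)) • f1 x).smulRight (f1 x)‖ :=
          norm_add_le _ _
      _ = |((f x) ^ 2)⁻¹| * ‖f2 x‖ + |2 * ((f x)⁻¹ * ((f x) ^ 2)⁻¹)| * ‖f1 x‖ * ‖f1 x‖ := by
          rw [norm_smul, Real.norm_eq_abs, abs_neg, ContinuousLinearMap.norm_smulRight_apply, norm_smul,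
            Real.norm_eq_abs]
      _ ≤ (m ^ 2)⁻¹ * Kf2 + 2 * (m⁻¹ * (m ^ 2)⁻¹) * Kf1 * Kf1 := by
          refine add_le_add (mul_le_mul (hb1 x) (hf2b x) (norm_nonneg _) (by positivity)) ?_
          exact mul_le_mul (mul_le_mul (hb3 x) (hf1b x) (norm_nonneg _) (by positivity)) (hf1b x)
            (norm_nonneg _) (by positivity)
  · refine (uc_smul hu_negsq hfu hb1' hf2b).add ?_
    refine uc_smulRight ?_ hfu1 (Cc := 2 * (m⁻¹ * (m ^ 2)⁻¹) * Kf1) (fun x => ?_) hf1b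
    · exact uc_smul hu3 hfu1 hb3 hf1b
    · rw [norm_smul, Real.norm_eq_abs]
      exact mul_le_mul (hb3 x) (hf1b x) (norm_nonneg _) (by positivity)

/-- Scalar multiple with `C_b²` data. [cite: Rudin1976, Thm 5.3] -/
theorem cb2_const_mul (c : ℝ)
    (hf : (∀ x, HasFDerivAt f (f1 x) x) ∧ (∀ x, HasFDerivAt f1 (f2 x) x) ∧ (∀ x, |f x| ≤ Kf0) ∧
      (∀ x, ‖f1 x‖ ≤ Kf1) ∧ (∀ x, ‖f2 x‖ ≤ Kf2) ∧ UniformContinuous f2) :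
    (∀ x, HasFDerivAt (fun x => c * f x) (c • f1 x) x) ∧
    (∀ x, HasFDerivAt (fun x => c • f1 x) (c • f2 x) x) ∧
    (∀ x, |c * f x| ≤ |c| * Kf0) ∧ (∀ x, ‖c • f1 x‖ ≤ |c| * Kf1) ∧ (∀ x, ‖c • f2 x‖ ≤ |c| * Kf2) ∧
    UniformContinuous (fun x => c • f2 x) := by
  obtain ⟨hf1, hf2, hf0b, hf1b, hf2b, hfu⟩ := hf
  refine ⟨fun x => ?_, fun x => (hf2 x).const_smul c, fun x => ?_, fun x => ?_, fun x => ?_, ?_⟩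
  · exact (hf1 x).const_smul c
  · rw [abs_mul]; exact mul_le_mul_of_nonneg_left (hf0b x) (abs_nonneg c)
  · rw [norm_smul, Real.norm_eq_abs]; exact mul_le_mul_of_nonneg_left (hf1b x) (abs_nonneg c)
  · rw [norm_smul, Real.norm_eq_abs]; exact mul_le_mul_of_nonneg_left (hf2b x) (abs_nonneg c)
  · exact uc_smul uniformContinuous_const hfu (fun _ => le_rfl) hf2b

/-- Sum with `C_b²` data. [cite: Rudin1976, Thm 5.3] -/
theorem cb2_add
    (hf : (∀ x, HasFDerivAt f (f1 x) x) ∧ (∀ x, HasFDerivAt f1 (f2 x) x) ∧ (∀ x, |f x| ≤ Kf0) ∧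
      (∀ x, ‖f1 x‖ ≤ Kf1) ∧ (∀ x, ‖f2 x‖ ≤ Kf2) ∧ UniformContinuous f2)
    (hg : (∀ x, HasFDerivAt g (g1 x) x) ∧ (∀ x, HasFDerivAt g1 (g2 x) x) ∧ (∀ x, |g x| ≤ Kg0) ∧
      (∀ x, ‖g1 x‖ ≤ Kg1) ∧ (∀ x, ‖g2 x‖ ≤ Kg2) ∧ UniformContinuous g2) :
    (∀ x, HasFDerivAt (fun x => f x + g x) (f1 x + g1 x) x) ∧
    (∀ x, HasFDerivAt (fun x => f1 x + g1 x) (f2 x + g2 x) x) ∧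
    (∀ x, |f x + g x| ≤ Kf0 + Kg0) ∧ (∀ x, ‖f1 x + g1 x‖ ≤ Kf1 + Kg1) ∧ (∀ x, ‖f2 x + g2 x‖ ≤ Kf2 + Kg2) ∧
    UniformContinuous (fun x => f2 x + g2 x) := by
  obtain ⟨hf1, hf2, hf0b, hf1b, hf2b, hfu⟩ := hf
  obtain ⟨hg1, hg2, hg0b, hg1b, hg2b, hgu⟩ := hg
  exact ⟨fun x => (hf1 x).add (hg1 x), fun x => (hf2 x).add (hg2 x),
    fun x => (abs_add_le _ _).trans (add_le_add (hf0b x) (hg0b x)),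
    fun x => (norm_add_le _ _).trans (add_le_add (hf1b x) (hg1b x)),
    fun x => (norm_add_le _ _).trans (add_le_add (hf2b x) (hg2b x)), hfu.add hgu⟩

/-- Difference with `C_b²` data. [cite: Rudin1976, Thm 5.3] -/
theorem cb2_sub
    (hf : (∀ x, HasFDerivAt f (f1 x) x) ∧ (∀ x, HasFDerivAt f1 (f2 x) x) ∧ (∀ x, |f x| ≤ Kf0) ∧
      (∀ x, ‖f1 x‖ ≤ Kf1) ∧ (∀ x, ‖f2 x‖ ≤ Kf2) ∧ UniformContinuous f2)
    (hg : (∀ x, HasFDerivAt g (g1 x) x) ∧ (∀ x, HasFDerivAt g1 (g2 x) x) ∧ (∀ x, |g x| ≤ Kg0) ∧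
      (∀ x, ‖g1 x‖ ≤ Kg1) ∧ (∀ x, ‖g2 x‖ ≤ Kg2) ∧ UniformContinuous g2) :
    (∀ x, HasFDerivAt (fun x => f x - g x) (f1 x - g1 x) x) ∧
    (∀ x, HasFDerivAt (fun x => f1 x - g1 x) (f2 x - g2 x) x) ∧
    (∀ x, |f x - g x| ≤ Kf0 + Kg0) ∧ (∀ x, ‖f1 x - g1 x‖ ≤ Kf1 + Kg1) ∧ (∀ x, ‖f2 x - g2 x‖ ≤ Kf2 + Kg2) ∧
    UniformContinuous (fun x => f2 x - g2 x) := by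
  obtain ⟨hf1, hf2, hf0b, hf1b, hf2b, hfu⟩ := hf
  obtain ⟨hg1, hg2, hg0b, hg1b, hg2b, hgu⟩ := hg
  exact ⟨fun x => (hf1 x).sub (hg1 x), fun x => (hf2 x).sub (hg2 x),
    fun x => (abs_sub _ _).trans (add_le_add (hf0b x) (hg0b x)),
    fun x => (norm_sub_le _ _).trans (add_le_add (hf1b x) (hg1b x)),
    fun x => (norm_sub_le _ _).trans (add_le_add (hf2b x) (hg2b x)), hfu.sub hgu⟩

/-- Finite sums with `C_b²` data and uniform constants. [cite: Rudin1976, Thm 5.3] -/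
theorem cb2_sum {ι : Type*} [DecidableEq ι] (S : Finset ι) {F : ι → EuclideanSpace ℝ (Fin N) → ℝ}
    {F1 : ι → EuclideanSpace ℝ (Fin N) → EuclideanSpace ℝ (Fin N) →L[ℝ] ℝ}
    {F2 : ι → EuclideanSpace ℝ (Fin N) → EuclideanSpace ℝ (Fin N) →L[ℝ] EuclideanSpace ℝ (Fin N) →L[ℝ] ℝ}
    {K0 K1 K2 : ℝ}
    (h : ∀ i ∈ S, (∀ x, HasFDerivAt (F i) (F1 i x) x) ∧ (∀ x, HasFDerivAt (F1 i) (F2 i x) x) ∧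
      (∀ x, |F i x| ≤ K0) ∧ (∀ x, ‖F1 i x‖ ≤ K1) ∧ (∀ x, ‖F2 i x‖ ≤ K2) ∧ UniformContinuous (F2 i)) :
    (∀ x, HasFDerivAt (fun x => ∑ i ∈ S, F i x) (∑ i ∈ S, F1 i x) x) ∧
    (∀ x, HasFDerivAt (fun x => ∑ i ∈ S, F1 i x) (∑ i ∈ S, F2 i x) x) ∧
    (∀ x, |∑ i ∈ S, F i x| ≤ S.card * K0) ∧ (∀ x, ‖∑ i ∈ S, F1 i x‖ ≤ S.card * K1) ∧
    (∀ x, ‖∑ i ∈ S, F2 i x‖ ≤ S.card * K2) ∧ UniformContinuous (fun x => ∑ i ∈ S, F2 i x) := by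
  refine ⟨fun x => ?_, fun x => ?_, fun x => ?_, fun x => ?_, fun x => ?_, ?_⟩
  · exact HasFDerivAt.fun_sum fun i hi => (h i hi).1 x
  · exact HasFDerivAt.fun_sum fun i hi => (h i hi).2.1 x
  · calc |∑ i ∈ S, F i x| ≤ ∑ i ∈ S, |F i x| := Finset.abs_sum_le_sum_abs _ _
      _ ≤ ∑ i ∈ S, K0 := Finset.sum_le_sum fun i hi => (h i hi).2.2.1 x
      _ = S.card * K0 := by rw [Finset.sum_const, nsmul_eq_mul]
  · calc ‖∑ i ∈ S, F1 i x‖ ≤ ∑ i ∈ S, ‖F1 i x‖ := norm_sum_le _ _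
      _ ≤ ∑ i ∈ S, K1 := Finset.sum_le_sum fun i hi => (h i hi).2.2.2.1 x
      _ = S.card * K1 := by rw [Finset.sum_const, nsmul_eq_mul]
  · calc ‖∑ i ∈ S, F2 i x‖ ≤ ∑ i ∈ S, ‖F2 i x‖ := norm_sum_le _ _
      _ ≤ ∑ i ∈ S, K2 := Finset.sum_le_sum fun i hi => (h i hi).2.2.2.2.1 x
      _ = S.card * K2 := by rw [Finset.sum_const, nsmul_eq_mul]
  · exact uc_finset_sum S F2 fun i hi => (h i hi).2.2.2.2.2

end Cb2

/-! ### Uniform time slopes: inverse, space-independent factors, sums -/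

section Slope

variable {α : Type*} {t : ℝ}

/-- `|s − t|` is eventually small. [folklore] -/
private theorem eventually_abs_sub_lt' (t : ℝ) {c : ℝ} (hc : 0 < c) : ∀ᶠ s in 𝓝 t, |s - t| < c := by
  have h0 : Tendsto (fun s : ℝ => s - t) (𝓝 t) (𝓝 (t - t)) := tendsto_id.sub_const t
  rw [sub_self] at h0
  have h := h0.abs
  rw [abs_zero] at h
  exact (tendsto_order.1 h).2 _ hc

/-- Transfer of a uniform slope along a pointwise identity of the slope function. [cite: Rudin1976, Thm 5.3] -/
theorem uniformSlope_congr {f : ℝ → α → ℝ} {fd fd' : α → ℝ}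
    (hf : ∀ ε : ℝ, 0 < ε → ∀ᶠ s in 𝓝 t, ∀ y, |f s y - f t y - (s - t) * fd y| ≤ ε * |s - t|)
    (h : ∀ y, fd y = fd' y) :
    ∀ ε : ℝ, 0 < ε → ∀ᶠ s in 𝓝 t, ∀ y, |f s y - f t y - (s - t) * fd' y| ≤ ε * |s - t| := by
  have : fd = fd' := funext h
  subst this
  exact hf

/-- A space-independent differentiable factor has a uniform slope (e.g. the entries `Ċ_s^{ij}` of the
covariance decomposition). [cite: Rudin1976, Thm 5.3] -/
theorem uniformSlope_of_hasDerivAt {c : ℝ → ℝ} {c' : ℝ} (hc : HasDerivAt c c' t) :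
    ∀ ε : ℝ, 0 < ε → ∀ᶠ s in 𝓝 t, ∀ _y : α, |c s - c t - (s - t) * c'| ≤ ε * |s - t| := by
  intro ε hε
  have h := (hasDerivAt_iff_isLittleO.1 hc).bound hε
  filter_upwards [h] with s hs y
  simp only [smul_eq_mul, Real.norm_eq_abs] at hs
  exact hs

/-- **Quotient rule, uniform version**: if `g_s ≥ m > 0` has the uniform slope `ġ` at `t` then `1/g_s` has
the uniform slope `−ġ/g_t²`. [cite: Rudin1976, Thm 5.3] -/
theorem uniformSlope_inv {g : ℝ → α → ℝ} {gd : α → ℝ}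
    (hg : ∀ ε : ℝ, 0 < ε → ∀ᶠ s in 𝓝 t, ∀ y, |g s y - g t y - (s - t) * gd y| ≤ ε * |s - t|)
    {m : ℝ} (hm : 0 < m) (hmg : ∀ s y, m ≤ g s y) {B' : ℝ} (hB0 : 0 ≤ B') (hB' : ∀ y, |gd y| ≤ B') :
    ∀ ε : ℝ, 0 < ε → ∀ᶠ s in 𝓝 t, ∀ y,
      |(g s y)⁻¹ - (g t y)⁻¹ - (s - t) * (-(gd y) / (g t y) ^ 2)| ≤ ε * |s - t| := by
  intro ε hε
  -- `|g_s − g_t| ≤ (B'+1)|s−t|` eventually, and the slope error with tolerance `ε m²/2`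
  have ev1 := hg (ε * m ^ 2 / 2) (by positivity)
  have ev2 := eventually_abs_sub_le_of_uniformSlope hg hB'
  have ev3 := eventually_abs_sub_lt' t (c := ε * m ^ 3 / (2 * (B' * (B' + 1) + 1))) (by positivity)
  filter_upwards [ev1, ev2, ev3] with s hs1 hs2 hs3 y
  set a : ℝ := |s - t| with ha
  have ha0 : 0 ≤ a := abs_nonneg _
  have hgs : 0 < g s y := hm.trans_le (hmg s y)
  have hgt : 0 < g t y := hm.trans_le (hmg t y)
  set r : ℝ := g s y - g t y - (s - t) * gd y with hr
  have h1 : |r| ≤ ε * m ^ 2 / 2 * a := hs1 y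
  have h2 : |g s y - g t y| ≤ (B' + 1) * a := hs2 y
  -- algebra: the error term
  have hdec : (g s y)⁻¹ - (g t y)⁻¹ - (s - t) * (-(gd y) / (g t y) ^ 2) =
      -(r / (g s y * g t y)) + (s - t) * gd y * (g s y - g t y) / (g s y * g t y ^ 2) := by
    rw [hr]
    field_simp
    ring
  rw [hdec]
  have hT1 : |-(r / (g s y * g t y))| ≤ ε * m ^ 2 / 2 * a / (m * m) := by
    rw [abs_neg, abs_div, abs_of_pos (mul_pos hgs hgt)]
    exact div_le_div₀ (by positivity) h1 (mul_pos hm hm) (mul_le_mul (hmg s y) (hmg t y) hm.le hgs.le)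
  have hT2 : |(s - t) * gd y * (g s y - g t y) / (g s y * g t y ^ 2)| ≤
      a * B' * ((B' + 1) * a) / (m * m ^ 2) := by
    rw [abs_div, abs_of_pos (mul_pos hgs (pow_pos hgt 2)), abs_mul, abs_mul, ← ha]
    refine div_le_div₀ (by positivity) ?_ (by positivity) ?_
    · exact mul_le_mul (mul_le_mul_of_nonneg_left (hB' y) ha0) h2 (abs_nonneg _) (by positivity)
    · exact mul_le_mul (hmg s y) (pow_le_pow_left₀ hm.le (hmg t y) 2) (by positivity) hgs.le
  have hN1 : ε * m ^ 2 / 2 * a / (m * m) = ε / 2 * a := by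
    field_simp
  have hN2 : a * B' * ((B' + 1) * a) / (m * m ^ 2) ≤ ε / 2 * a := by
    have hlt : (B' * (B' + 1) + 1) * a < ε * m ^ 3 / 2 := by
      have := hs3
      rw [lt_div_iff₀ (by positivity)] at this
      linarith
    have hle : B' * (B' + 1) * a ≤ ε * m ^ 3 / 2 := by nlinarith [mul_nonneg hB0 ha0]
    rw [div_le_iff₀ (by positivity)]
    calc a * B' * ((B' + 1) * a) = (B' * (B' + 1) * a) * a := by ring
      _ ≤ (ε * m ^ 3 / 2) * a := mul_le_mul_of_nonneg_right hle ha0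
      _ = ε / 2 * a * (m * m ^ 2) := by ring
  calc _ ≤ |-(r / (g s y * g t y))| + |(s - t) * gd y * (g s y - g t y) / (g s y * g t y ^ 2)| :=
        abs_add_le _ _
    _ ≤ ε / 2 * a + ε / 2 * a := add_le_add (hT1.trans hN1.le) (hT2.trans hN2)
    _ = ε * a := by ring

/-- Difference rule for uniform slopes. [cite: Rudin1976, Thm 5.3] -/
theorem uniformSlope_sub {f g : ℝ → α → ℝ} {fd gd : α → ℝ}
    (hf : ∀ ε : ℝ, 0 < ε → ∀ᶠ s in 𝓝 t, ∀ y, |f s y - f t y - (s - t) * fd y| ≤ ε * |s - t|)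
    (hg : ∀ ε : ℝ, 0 < ε → ∀ᶠ s in 𝓝 t, ∀ y, |g s y - g t y - (s - t) * gd y| ≤ ε * |s - t|) :
    ∀ ε : ℝ, 0 < ε → ∀ᶠ s in 𝓝 t, ∀ y,
      |(f s y - g s y) - (f t y - g t y) - (s - t) * (fd y - gd y)| ≤ ε * |s - t| := by
  intro ε hε
  filter_upwards [hf (ε / 2) (half_pos hε), hg (ε / 2) (half_pos hε)] with s hs1 hs2 y
  have h1 := hs1 y
  have h2 := hs2 y
  have he : (f s y - g s y) - (f t y - g t y) - (s - t) * (fd y - gd y) =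
      (f s y - f t y - (s - t) * fd y) - (g s y - g t y - (s - t) * gd y) := by ring
  rw [he]
  calc _ ≤ |f s y - f t y - (s - t) * fd y| + |g s y - g t y - (s - t) * gd y| := abs_sub _ _
    _ ≤ ε / 2 * |s - t| + ε / 2 * |s - t| := add_le_add h1 h2
    _ = ε * |s - t| := by ring

/-- Finite sums of uniform slopes. [cite: Rudin1976, Thm 5.3] -/
theorem uniformSlope_sum {ι : Type*} (S : Finset ι) {f : ι → ℝ → α → ℝ} {fd : ι → α → ℝ}
    (hf : ∀ i ∈ S, ∀ ε : ℝ, 0 < ε → ∀ᶠ s in 𝓝 t, ∀ y,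
      |f i s y - f i t y - (s - t) * fd i y| ≤ ε * |s - t|) :
    ∀ ε : ℝ, 0 < ε → ∀ᶠ s in 𝓝 t, ∀ y,
      |(∑ i ∈ S, f i s y) - (∑ i ∈ S, f i t y) - (s - t) * ∑ i ∈ S, fd i y| ≤ ε * |s - t| := by
  intro ε hε
  have hcard : (0 : ℝ) < S.card + 1 := by positivity
  have hev : ∀ i ∈ S, ∀ᶠ s in 𝓝 t, ∀ y,
      |f i s y - f i t y - (s - t) * fd i y| ≤ ε / (S.card + 1) * |s - t| :=
    fun i hi => hf i hi _ (by positivity)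
  filter_upwards [(Finset.eventually_all S).2 hev] with s hs y
  have he : (∑ i ∈ S, f i s y) - (∑ i ∈ S, f i t y) - (s - t) * ∑ i ∈ S, fd i y =
      ∑ i ∈ S, (f i s y - f i t y - (s - t) * fd i y) := by
    rw [Finset.mul_sum, ← Finset.sum_sub_distrib, ← Finset.sum_sub_distrib]
  rw [he]
  calc _ ≤ ∑ i ∈ S, |f i s y - f i t y - (s - t) * fd i y| := Finset.abs_sum_le_sum_abs _ _
    _ ≤ ∑ i ∈ S, ε / (S.card + 1) * |s - t| := Finset.sum_le_sum fun i hi => hs i hi y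
    _ = S.card * (ε / (S.card + 1) * |s - t|) := by rw [Finset.sum_const, nsmul_eq_mul]
    _ ≤ ε * |s - t| := by
        rw [← mul_assoc]
        refine mul_le_mul_of_nonneg_right ?_ (abs_nonneg _)
        rw [mul_div_assoc', div_le_iff₀ hcard]
        nlinarith [abs_nonneg (s - t), S.card.cast_nonneg (α := ℝ)]

end Slope

end Polchinski

end Literature.Analysis.FunctionSpaces

end
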